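import Mathlib

/-!
# K-C3 §H2L piece K2b, brick 2 (W4.4b): residue separation modulo 3

[OURS · L1 w44b] The key injectivity mechanism for the normalisation `k⟦z,t⟧/(z³+t⁴) → k⟦s⟧` (`t ↦ s³`, `z ↦ -s⁴`):
if `a(s³) - s⁴·b(s³) + s⁸·c(s³) = 0` in `k⟦s⟧` then `a = b = c = 0`, because the three summands are supported on
exponents `≡ 0, 1, 2 (mod 3)` respectively.  Pure power-series bookkeeping (Mathlib `PowerSeries.expand`).
NOT a statement of the manuscript under review.
-/

set_option linter.dupNamespace false

noncomputable section

open PowerSeries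

namespace Summit.ResolutionOfSingularities.ResolutionOfSingularities.Theorems.HomologicalConductor.Cusp34

universe u

variable {R : Type u} [CommRing R]

/-- Coefficients of `s^e · φ(s³)`: zero unless `e ≤ m` and `3 ∣ m - e`, in which case it is the `(m-e)/3`-th
coefficient of `φ`. [OURS] -/
theorem coeff_X_pow_mul_expand_three (φ : PowerSeries R) (e m : ℕ) :
    coeff m (X ^ e * expand 3 (by norm_num) φ) =
      if e ≤ m ∧ 3 ∣ (m - e) then coeff ((m - e) / 3) φ else 0 := by
  rw [coeff_X_pow_mul', coeff_expand]
  by_cases h1 : e ≤ m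
  · by_cases h2 : 3 ∣ (m - e)
    · simp [h1, h2]
    · simp [h1, h2]
  · simp [h1]

/-- **Residue separation.** If `a(s³) - s⁴·b(s³) + s⁸·c(s³) = 0` then `a = 0`, `b = 0` and `c = 0`. [OURS] -/
theorem expand_three_separation (a b c : PowerSeries R)
    (h : expand 3 (by norm_num) a - X ^ 4 * expand 3 (by norm_num) b + X ^ 8 * expand 3 (by norm_num) c = 0) :
    a = 0 ∧ b = 0 ∧ c = 0 := by
  have key : ∀ m : ℕ, coeff m (expand 3 (by norm_num) a) - coeff m (X ^ 4 * expand 3 (by norm_num) b)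
      + coeff m (X ^ 8 * expand 3 (by norm_num) c) = 0 := by
    intro m
    have := congrArg (coeff m) h
    simpa [map_add, map_sub] using this
  refine ⟨?_, ?_, ?_⟩
  · ext n
    have hm := key (3 * n)
    rw [coeff_expand_mul, coeff_X_pow_mul_expand_three, coeff_X_pow_mul_expand_three] at hm
    have h4 : ¬ (4 ≤ 3 * n ∧ 3 ∣ (3 * n - 4)) := by
      rintro ⟨h41, h42⟩; omega
    have h8 : ¬ (8 ≤ 3 * n ∧ 3 ∣ (3 * n - 8)) := by
      rintro ⟨h81, h82⟩; omega
    simp only [h4, h8, if_false, sub_zero, add_zero] at hm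
    simpa using hm
  · ext n
    have hm := key (3 * n + 4)
    rw [coeff_expand_of_not_dvd 3 (by norm_num) a (by omega), coeff_X_pow_mul_expand_three,
      coeff_X_pow_mul_expand_three] at hm
    have h4 : (4 ≤ 3 * n + 4 ∧ 3 ∣ (3 * n + 4 - 4)) := ⟨by omega, ⟨n, by omega⟩⟩
    have h8 : ¬ (8 ≤ 3 * n + 4 ∧ 3 ∣ (3 * n + 4 - 8)) := by
      rintro ⟨h81, h82⟩; omega
    simp only [h4, h8, if_true, if_false, add_zero, zero_sub, neg_eq_zero, and_self] at hm
    have : (3 * n + 4 - 4) / 3 = n := by omega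
    rw [this] at hm
    simpa using hm
  · ext n
    have hm := key (3 * n + 8)
    rw [coeff_expand_of_not_dvd 3 (by norm_num) a (by omega), coeff_X_pow_mul_expand_three,
      coeff_X_pow_mul_expand_three] at hm
    have h4 : ¬ (4 ≤ 3 * n + 8 ∧ 3 ∣ (3 * n + 8 - 4)) := by
      rintro ⟨h41, h42⟩; omega
    have h8 : (8 ≤ 3 * n + 8 ∧ 3 ∣ (3 * n + 8 - 8)) := ⟨by omega, ⟨n, by omega⟩⟩
    simp only [h4, h8, if_true, if_false, zero_add, sub_zero, and_self] at hm
    have : (3 * n + 8 - 8) / 3 = n := by omega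
    rw [this] at hm
    simpa using hm

end Summit.ResolutionOfSingularities.ResolutionOfSingularities.Theorems.HomologicalConductor.Cusp34

end
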